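import Summits.Schanuel.Schanuel.Theorems.ZilberEacGraphSurfaceEscapeLog
import Summits.Schanuel.Schanuel.Theorems.ZilberEacGraphSurfaceEdge
import HarnessLib

/-!
# Non-split surfaces over a graph base, V: the upper edge and escaping exponential points for
# EVERY fibre polynomial with two `y₁`-degrees (balanced or not)

HONEST FRAMING.  Cell `pub-schanuel` (Zilber's Exponential-Algebraic Closedness, case ladder;
host summit Schanuel), seat 2, gen 17.  For `W(p; P) = {x₁ = p(x₀), P(x₀; y₀, y₁) = 0}`,
`deg p ≥ 2`, the exponential points are the zeros of `P(z; e^z, e^{p(z)})`.  Gen 16 read the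
lower-left edge `(s, m_b)` of the `y`-support and needed the edge to be BALANCED.  Here the balance
hypothesis is removed: inside the edge `M` we take an UPPER edge `(μ, κ)` of the points
`(m₂ - (m_b)₂, m₀)` (`exists_upper_edge`), whose polynomial has two monomials and hence a nonzero
root (`exists_root_ne_zero_of_coeff_ne_zero`), bound the off-edge part in the logarithmic window
`|Re R₀(z) - μ log ‖z‖| ≤ B` (`norm_offEdgeSum₃_le_log`), and run engine v3
(`exists_escape_zeros_log`): **`exists_graphSurface_expPoints`** — for EVERY `P ∈ ℂ[x, y₀, y₁]` with
two monomials of different `y₁`-degree there are solutions `z_k` of `P(z_k; e^{z_k}, e^{p(z_k)}) = 0`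
with `|Re z_k|/log(2 + ‖z_k‖) → ∞`.  Density: `ZilberEacGraphSurfaceAll`.  NOT Schanuel's conjecture
(neither used nor implied; EAC ⇏ SC); `EC(3,2)` stays OPEN; instances of Mantova–Masser's OPEN
question (PLMS 2024, §1 p. 5).

Variables of `P : MvPolynomial (Fin 3) ℂ`: `0 ↦ x (= x₀)`, `1 ↦ y₀`, `2 ↦ y₁`; weight
`w(m) = m₁ - s m₂`.
-/

noncomputable section

open Filter Topology Metric Set Complex
open Literature.ModelTheory.Zilber

set_option linter.dupNamespace false

namespace Summit.Schanuel.Schanuel.Theorems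

/-! ## Part A. An upper edge of a finite point set -/

/-- **An upper edge.**  For a finite set `A` with column `jf` and height `nf` having two elements
of different column, there are reals `μ, κ` with `nf a + μ·jf a ≤ κ` on `A` and equality at two
elements of different column (combinatorics only: the top row, then the least tilt). (new) -/
theorem exists_upper_edge {α : Type*} (A : Finset α) (jf nf : α → ℕ)
    (h2 : ∃ a ∈ A, ∃ a' ∈ A, jf a ≠ jf a') :
    ∃ μ κ : ℝ, (∀ a ∈ A, (nf a : ℝ) + μ * jf a ≤ κ) ∧
      ∃ a ∈ A, ∃ a' ∈ A, jf a ≠ jf a' ∧ (nf a : ℝ) + μ * jf a = κ ∧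
        (nf a' : ℝ) + μ * jf a' = κ := by
  classical
  obtain ⟨a₁, ha₁, a₁', ha₁', hne⟩ := h2
  obtain ⟨a₀, ha₀, hmax⟩ := A.exists_max_image (fun a => nf a) ⟨a₁, ha₁⟩
  set T := A.filter (fun a => jf a ≠ jf a₀) with hT
  have hTne : T.Nonempty := by
    by_cases h : jf a₁ = jf a₀
    · refine ⟨a₁', Finset.mem_filter.2 ⟨ha₁', ?_⟩⟩
      rw [← h]; exact fun h' => hne h'.symm
    · exact ⟨a₁, Finset.mem_filter.2 ⟨ha₁, h⟩⟩
  obtain ⟨as, hasT, hasmin⟩ := T.exists_min_image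
    (fun a => ((nf a₀ : ℝ) - nf a) / |(jf a : ℝ) - jf a₀|) hTne
  have hasA : as ∈ A := (Finset.mem_filter.1 hasT).1
  have hasj : jf as ≠ jf a₀ := (Finset.mem_filter.1 hasT).2
  have hD : ((jf as : ℝ) - jf a₀) ≠ 0 := by
    intro h; apply hasj; exact_mod_cast (sub_eq_zero.1 h)
  set μ : ℝ := ((nf a₀ : ℝ) - nf as) / ((jf as : ℝ) - jf a₀) with hμ
  refine ⟨μ, (nf a₀ : ℝ) + μ * jf a₀, fun a ha => ?_, a₀, ha₀, as, hasA,
    fun h => hasj h.symm, rfl, ?_⟩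
  · have hN : (nf a : ℝ) ≤ nf a₀ := by exact_mod_cast hmax a ha
    by_cases h1 : jf a = jf a₀
    · rw [h1]; linarith
    · have haT : a ∈ T := Finset.mem_filter.2 ⟨ha, h1⟩
      have hDa : ((jf a : ℝ) - jf a₀) ≠ 0 := by
        intro h; apply h1; exact_mod_cast (sub_eq_zero.1 h)
      have hDpos : 0 < |(jf a : ℝ) - jf a₀| := abs_pos.2 hDa
      have hNs : (nf as : ℝ) ≤ nf a₀ := by exact_mod_cast hmax as hasA
      have hr := hasmin a haT
      have habs : |μ| = ((nf a₀ : ℝ) - nf as) / |(jf as : ℝ) - jf a₀| := by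
        rw [hμ, abs_div, abs_of_nonneg (by linarith)]
      have h3 : μ * ((jf a : ℝ) - jf a₀) ≤ (nf a₀ : ℝ) - nf a := by
        calc μ * ((jf a : ℝ) - jf a₀) ≤ |μ * ((jf a : ℝ) - jf a₀)| := le_abs_self _
          _ = ((nf a₀ : ℝ) - nf as) / |(jf as : ℝ) - jf a₀| * |(jf a : ℝ) - jf a₀| := by
              rw [abs_mul, habs]
          _ ≤ ((nf a₀ : ℝ) - nf a) / |(jf a : ℝ) - jf a₀| * |(jf a : ℝ) - jf a₀| :=
              mul_le_mul_of_nonneg_right hr hDpos.le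
          _ = (nf a₀ : ℝ) - nf a := div_mul_cancel₀ _ hDpos.ne'
      linarith
  · have : μ * ((jf as : ℝ) - jf a₀) = (nf a₀ : ℝ) - nf as := by
      rw [hμ]; exact div_mul_cancel₀ _ hD
    linarith

/-! ## Part B. A polynomial with two monomials has a nonzero root -/

/-- **A polynomial over `ℂ` with nonzero coefficients in two different degrees has a nonzero
root** (divide by `X` until the constant term is nonzero). [folklore] -/
theorem exists_root_ne_zero_of_coeff_ne_zero :
    ∀ (n : ℕ) (Q : Polynomial ℂ) (i : ℕ), i < n → Q.coeff i ≠ 0 → Q.coeff n ≠ 0 →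
      ∃ θ : ℂ, θ ≠ 0 ∧ Q.eval θ = 0 := by
  intro n
  induction n with
  | zero => intro Q i hi; omega
  | succ n ih =>
    intro Q i hi hci hcn
    by_cases h0 : Q.coeff 0 = 0
    · have hi0 : i ≠ 0 := by rintro rfl; exact hci h0
      obtain ⟨i', rfl⟩ := Nat.exists_eq_succ_of_ne_zero hi0
      have hQ : Q.divX * Polynomial.X = Q := by
        have := Polynomial.divX_mul_X_add Q
        rwa [h0, map_zero, add_zero] at this
      obtain ⟨θ, hθ0, hθ⟩ := ih Q.divX i' (by omega) (by rwa [Polynomial.coeff_divX])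
        (by rwa [Polynomial.coeff_divX])
      refine ⟨θ, hθ0, ?_⟩
      rw [← hQ, Polynomial.eval_mul, hθ, zero_mul]
    · have hdeg : 0 < Q.natDegree :=
        lt_of_lt_of_le (Nat.succ_pos n) (Polynomial.le_natDegree_of_ne_zero hcn)
      obtain ⟨θ, hθ⟩ := Complex.exists_root (Polynomial.natDegree_pos_iff_degree_pos.1 hdeg)
      refine ⟨θ, ?_, hθ⟩
      rintro rfl
      apply h0
      rw [Polynomial.coeff_zero_eq_eval_zero]
      exact hθ

/-! ## Part C. The off-edge part in the logarithmic window -/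

section EdgeSum

variable {p : Polynomial ℂ} {P : MvPolynomial (Fin 3) ℂ} {s : ℝ} {mb : Fin 3 →₀ ℕ}

/-- **The off-edge part in the window `|Re R₀(z) - μ log ‖z‖| ≤ B`**: with `δ > 0` at most every
positive weight gap, `N` bounding the `x`-degrees and `N' ≥ |m₂ - (m_b)₂| |μ|` on the support, for
`Re z ≤ 0`, `‖z‖ ≥ 1`:
`‖E(z)‖ ≤ (Σ_{m ∉ M} ‖c_m‖ e^{|m₂ - (m_b)₂| B}) (1 + ‖z‖)^{N + N'} e^{δ Re z}`. (new) -/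
theorem norm_offEdgeSum₃_le_log {δ B μ : ℝ} {N N' : ℕ}
    (hδ : ∀ m ∈ P.support, ¬ ((m 1 : ℝ) - s * m 2) = (mb 1 : ℝ) - s * mb 2 →
      δ ≤ ((m 1 : ℝ) - s * m 2) - ((mb 1 : ℝ) - s * mb 2))
    (hN : ∀ m ∈ P.support, m 0 ≤ N)
    (hN' : ∀ m ∈ P.support, |(m 2 : ℝ) - mb 2| * |μ| ≤ N')
    {z : ℂ} (hz : z.re ≤ 0) (hz1 : 1 ≤ ‖z‖)
    (hB : |((p + Polynomial.C (s : ℂ) * Polynomial.X).eval z).re - μ * Real.log ‖z‖| ≤ B) :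
    ‖∑ m ∈ P.support.filter
          (fun m : Fin 3 →₀ ℕ => ¬ ((m 1 : ℝ) - s * m 2) = (mb 1 : ℝ) - s * mb 2),
        P.coeff m * z ^ (m 0) *
          exp ((((m 1 : ℝ) - s * m 2 - ((mb 1 : ℝ) - s * mb 2) : ℝ) : ℂ) * z +
            (((m 2 : ℝ) - mb 2 : ℝ) : ℂ) * (p + Polynomial.C (s : ℂ) * Polynomial.X).eval z)‖ ≤
      (∑ m ∈ P.support.filter
          (fun m : Fin 3 →₀ ℕ => ¬ ((m 1 : ℝ) - s * m 2) = (mb 1 : ℝ) - s * mb 2),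
          ‖P.coeff m‖ * Real.exp (|(m 2 : ℝ) - mb 2| * B)) * (1 + ‖z‖) ^ (N + N') *
        Real.exp (δ * z.re) := by
  classical
  set R₀ := p + Polynomial.C (s : ℂ) * Polynomial.X with hR₀
  rw [Finset.sum_mul, Finset.sum_mul]
  refine (norm_sum_le _ _).trans (Finset.sum_le_sum fun m hm => ?_)
  obtain ⟨hmA, hmw⟩ := Finset.mem_filter.1 hm
  rw [norm_mul, norm_mul, norm_pow, Complex.norm_exp, Complex.add_re, Complex.re_ofReal_mul,
    Complex.re_ofReal_mul]
  have hlog0 : 0 ≤ Real.log ‖z‖ := Real.log_nonneg hz1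
  have h1 : ((m 1 : ℝ) - s * m 2 - ((mb 1 : ℝ) - s * mb 2)) * z.re ≤ δ * z.re :=
    mul_le_mul_of_nonpos_right (hδ m hmA hmw) hz
  -- `Δ Re R₀ = Δ (Re R₀ - μ log ‖z‖) + Δ μ log ‖z‖ ≤ |Δ| B + |Δ| |μ| log ‖z‖`
  have h2 : ((m 2 : ℝ) - mb 2) * (R₀.eval z).re ≤
      |(m 2 : ℝ) - mb 2| * B + |(m 2 : ℝ) - mb 2| * |μ| * Real.log ‖z‖ := by
    have e1 : ((m 2 : ℝ) - mb 2) * (R₀.eval z).re =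
        ((m 2 : ℝ) - mb 2) * ((R₀.eval z).re - μ * Real.log ‖z‖) +
          ((m 2 : ℝ) - mb 2) * μ * Real.log ‖z‖ := by ring
    rw [e1]
    refine add_le_add ?_ ?_
    · refine (le_abs_self _).trans ?_
      rw [abs_mul]
      exact mul_le_mul_of_nonneg_left hB (abs_nonneg _)
    · have : ((m 2 : ℝ) - mb 2) * μ ≤ |(m 2 : ℝ) - mb 2| * |μ| := by
        rw [← abs_mul]; exact le_abs_self _
      exact mul_le_mul_of_nonneg_right this hlog0
  have hzN : ‖z‖ ^ (m 0) ≤ (1 + ‖z‖) ^ N :=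
    (pow_le_pow_left₀ (norm_nonneg _) (by linarith [norm_nonneg z]) _).trans
      (pow_le_pow_right₀ (by linarith [norm_nonneg z]) (hN m hmA))
  have hzN' : Real.exp (|(m 2 : ℝ) - mb 2| * |μ| * Real.log ‖z‖) ≤ (1 + ‖z‖) ^ N' :=
    exp_mul_log_le_pow (hN' m hmA) hz1 (by linarith)
  have hexp : Real.exp (((m 1 : ℝ) - s * m 2 - ((mb 1 : ℝ) - s * mb 2)) * z.re +
      ((m 2 : ℝ) - mb 2) * (R₀.eval z).re) ≤
      Real.exp (|(m 2 : ℝ) - mb 2| * B) * (1 + ‖z‖) ^ N' * Real.exp (δ * z.re) := by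
    calc Real.exp (((m 1 : ℝ) - s * m 2 - ((mb 1 : ℝ) - s * mb 2)) * z.re +
          ((m 2 : ℝ) - mb 2) * (R₀.eval z).re)
        ≤ Real.exp (|(m 2 : ℝ) - mb 2| * B + |(m 2 : ℝ) - mb 2| * |μ| * Real.log ‖z‖ +
            δ * z.re) := Real.exp_le_exp.2 (by linarith)
      _ = Real.exp (|(m 2 : ℝ) - mb 2| * B) *
            Real.exp (|(m 2 : ℝ) - mb 2| * |μ| * Real.log ‖z‖) * Real.exp (δ * z.re) := by
          rw [Real.exp_add, Real.exp_add]
      _ ≤ Real.exp (|(m 2 : ℝ) - mb 2| * B) * (1 + ‖z‖) ^ N' * Real.exp (δ * z.re) := by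
          gcongr
  calc ‖P.coeff m‖ * ‖z‖ ^ (m 0) * Real.exp (((m 1 : ℝ) - s * m 2 - ((mb 1 : ℝ) - s * mb 2)) *
        z.re + ((m 2 : ℝ) - mb 2) * (R₀.eval z).re)
      ≤ ‖P.coeff m‖ * (1 + ‖z‖) ^ N *
          (Real.exp (|(m 2 : ℝ) - mb 2| * B) * (1 + ‖z‖) ^ N' * Real.exp (δ * z.re)) :=
        mul_le_mul (mul_le_mul_of_nonneg_left hzN (norm_nonneg _)) hexp (Real.exp_nonneg _)
          (by positivity)
    _ = ‖P.coeff m‖ * Real.exp (|(m 2 : ℝ) - mb 2| * B) * (1 + ‖z‖) ^ (N + N') *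
          Real.exp (δ * z.re) := by
        rw [pow_add]; ring

end EdgeSum

/-! ## Part D. Escaping exponential points for every `P` with two `y₁`-degrees -/

/-- **Escaping zeros of `P(z; e^z, e^{p(z)})`, no balance hypothesis.**  Let `deg p ≥ 2` and let
`P ∈ ℂ[x, y₀, y₁]` have two monomials of different `y₁`-degree.  Then there are `z_k` with
`P(z_k; e^{z_k}, e^{p(z_k)}) = 0` and `|Re z_k|/log(2 + ‖z_k‖) → ∞` (lower-left edge `(s, m_b)` of the
`y`-support; upper edge `(μ, κ)` of the edge points `(m₂ - (m_b)₂, m₀)`; engine v3 along the roots of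
`p(z) + sz - μ L = 2πiN + log θ`). (new) -/
theorem exists_graphSurface_expPoints (p : Polynomial ℂ) (hd : 2 ≤ p.natDegree)
    (P : MvPolynomial (Fin 3) ℂ) (h2 : ∃ m ∈ P.support, ∃ m' ∈ P.support, m 2 ≠ m' 2) :
    ∃ z : ℕ → ℂ, (∀ k, MvPolynomial.eval ![z k, exp (z k), exp (p.eval (z k))] P = 0) ∧
      Tendsto (fun k => |(z k).re| / Real.log (2 + ‖z k‖)) atTop atTop := by
  classical
  obtain ⟨s, mb, hmb, hE1, hE2, ms, hmsA, hms2, hmsw⟩ := exists_lowerLeft_edge₃ P.support h2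
  set R₀ : Polynomial ℂ := p + Polynomial.C (s : ℂ) * Polynomial.X with hR₀
  have hdeg : R₀.natDegree = p.natDegree := by
    rw [hR₀]
    apply Polynomial.natDegree_add_eq_left_of_natDegree_lt
    calc (Polynomial.C (s : ℂ) * Polynomial.X).natDegree ≤ Polynomial.X.natDegree :=
          Polynomial.natDegree_C_mul_le _ _
      _ ≤ 1 := Polynomial.natDegree_X_le
      _ < p.natDegree := by omega
  have hdR : 2 ≤ R₀.natDegree := by rw [hdeg]; exact hd
  set M := P.support.filter
    (fun m : Fin 3 →₀ ℕ => ((m 1 : ℝ) - s * m 2) = (mb 1 : ℝ) - s * mb 2) with hM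
  set Nf := P.support.filter
    (fun m : Fin 3 →₀ ℕ => ¬ ((m 1 : ℝ) - s * m 2) = (mb 1 : ℝ) - s * mb 2) with hNf
  have hmbM : mb ∈ M := Finset.mem_filter.2 ⟨hmb, rfl⟩
  have hmsM : ms ∈ M := Finset.mem_filter.2 ⟨hmsA, hmsw⟩
  have hMle : ∀ m ∈ M, mb 2 ≤ m 2 := fun m hm =>
    hE2 m (Finset.mem_filter.1 hm).1 (Finset.mem_filter.1 hm).2
  -- the coefficient polynomials and exponents of the edge sum
  set q : (Fin 3 →₀ ℕ) → Polynomial ℂ := fun m =>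
    Polynomial.C (P.coeff m) * Polynomial.X ^ (m 0) with hq_def
  set e : (Fin 3 →₀ ℕ) → ℕ := fun m => m 2 - mb 2 with he_def
  have hq_deg : ∀ m ∈ M, (q m).natDegree = m 0 := fun m hm =>
    Polynomial.natDegree_C_mul_X_pow _ _
      (MvPolynomial.mem_support_iff.1 (Finset.mem_filter.1 hm).1)
  have hq_lc : ∀ m, (q m).leadingCoeff = P.coeff m := fun m =>
    Polynomial.leadingCoeff_C_mul_X_pow _ _
  -- the upper edge `(μ, κ)` of the edge points `(m₂ - (m_b)₂, m₀)`
  obtain ⟨μ, κ, hκ, ma, hma, mc, hmc, hjne, hja, hjc⟩ := exists_upper_edge M e (fun m => m 0)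
    ⟨mb, hmbM, ms, hmsM, by
      have hlt : mb 2 < ms 2 := lt_of_le_of_ne (hMle ms hmsM) (Ne.symm hms2)
      simp only [he_def]; omega⟩
  have hκ' : ∀ m ∈ M, ((q m).natDegree : ℝ) + μ * e m ≤ κ := fun m hm => by
    rw [hq_deg m hm]; exact hκ m hm
  -- the top set and its polynomial
  set Jt := M.filter (fun m => ((q m).natDegree : ℝ) + μ * e m = κ) with hJt
  set Qμ : Polynomial ℂ := ∑ m ∈ Jt, Polynomial.C (q m).leadingCoeff * Polynomial.X ^ (e m)
    with hQμ
  have hmem_top : ∀ {m}, m ∈ M → ((m 0 : ℝ) + μ * e m = κ) → m ∈ Jt := fun {m} hm h =>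
    Finset.mem_filter.2 ⟨hm, by rw [hq_deg m hm]; exact h⟩
  have hmaT : ma ∈ Jt := hmem_top hma hja
  have hmcT : mc ∈ Jt := hmem_top hmc hjc
  -- distinct top exponents have distinct `e`
  have hinj : ∀ m ∈ Jt, ∀ m' ∈ Jt, e m = e m' → m = m' := by
    intro m hm m' hm' hee
    obtain ⟨hmM, hmt⟩ := Finset.mem_filter.1 hm
    obtain ⟨hm'M, hm't⟩ := Finset.mem_filter.1 hm'
    have h2eq : m 2 = m' 2 := by
      have := hMle m hmM; have := hMle m' hm'M
      simp only [he_def] at hee; omega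
    have h0eq : m 0 = m' 0 := by
      rw [hq_deg m hmM] at hmt; rw [hq_deg m' hm'M] at hm't
      rw [hee] at hmt
      have : (m 0 : ℝ) = m' 0 := by linarith
      exact_mod_cast this
    exact gse_eq_of_weight_eq ((Finset.mem_filter.1 hmM).2.trans (Finset.mem_filter.1 hm'M).2.symm)
      h2eq h0eq
  -- the coefficient of `Q_μ` at `e m₁` (`m₁` top) is `c_{m₁} ≠ 0`
  have hcoeff : ∀ m₁ ∈ Jt, Qμ.coeff (e m₁) = P.coeff m₁ := by
    intro m₁ hm₁
    rw [hQμ, Polynomial.finsetSum_coeff, Finset.sum_eq_single m₁]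
    · rw [Polynomial.coeff_C_mul, Polynomial.coeff_X_pow, if_pos rfl, mul_one, hq_lc]
    · intro m hm hne
      rw [Polynomial.coeff_C_mul, Polynomial.coeff_X_pow, if_neg, mul_zero]
      exact fun h => hne (hinj m hm m₁ hm₁ h.symm)
    · intro h; exact (h hm₁).elim
  have hca : Qμ.coeff (e ma) ≠ 0 := by
    rw [hcoeff ma hmaT]; exact MvPolynomial.mem_support_iff.1 (Finset.mem_filter.1 hma).1
  have hcc : Qμ.coeff (e mc) ≠ 0 := by
    rw [hcoeff mc hmcT]; exact MvPolynomial.mem_support_iff.1 (Finset.mem_filter.1 hmc).1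
  -- a nonzero root of `Q_μ`, and `Q_μ ≠ 0`
  obtain ⟨θ, hθ0, hθ⟩ : ∃ θ : ℂ, θ ≠ 0 ∧ Qμ.eval θ = 0 := by
    rcases lt_or_gt_of_ne hjne with hlt | hgt
    · exact exists_root_ne_zero_of_coeff_ne_zero (e mc) Qμ (e ma) hlt hca hcc
    · exact exists_root_ne_zero_of_coeff_ne_zero (e ma) Qμ (e mc) hgt hcc hca
  have hQ : Qμ ≠ 0 := fun h => hca (by rw [h, Polynomial.coeff_zero])
  -- the weight gap `δ`, the degree bounds `N`, `N'`
  obtain ⟨δ, hδpos, hδ⟩ : ∃ δ : ℝ, 0 < δ ∧ ∀ m ∈ P.support,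
      ¬ ((m 1 : ℝ) - s * m 2) = (mb 1 : ℝ) - s * mb 2 →
        δ ≤ ((m 1 : ℝ) - s * m 2) - ((mb 1 : ℝ) - s * mb 2) := by
    by_cases hNe : Nf.Nonempty
    · obtain ⟨mm, hmm, hmmmin⟩ := Nf.exists_min_image
        (fun m => ((m 1 : ℝ) - s * m 2) - ((mb 1 : ℝ) - s * mb 2)) hNe
      obtain ⟨hmmA, hmmw⟩ := Finset.mem_filter.1 hmm
      refine ⟨((mm 1 : ℝ) - s * mm 2) - ((mb 1 : ℝ) - s * mb 2), ?_, fun m hm hmw =>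
        hmmmin m (Finset.mem_filter.2 ⟨hm, hmw⟩)⟩
      have := hE1 mm hmmA
      rcases this.lt_or_eq with h | h
      · linarith
      · exact absurd h.symm hmmw
    · refine ⟨1, zero_lt_one, fun m hm hmw => ?_⟩
      exact absurd ⟨m, Finset.mem_filter.2 ⟨hm, hmw⟩⟩ hNe
  set N : ℕ := P.support.sup (fun m => m 0) with hNdef
  have hN : ∀ m ∈ P.support, m 0 ≤ N := fun m hm => Finset.le_sup (f := fun m => m 0) hm
  set N₂ : ℕ := P.support.sup (fun m => m 2) with hN₂def
  have hN₂ : ∀ m ∈ P.support, m 2 ≤ N₂ := fun m hm => Finset.le_sup (f := fun m => m 2) hm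
  set N' : ℕ := ⌈(N₂ : ℝ) * |μ|⌉₊ with hN'def
  have hN' : ∀ m ∈ P.support, |(m 2 : ℝ) - mb 2| * |μ| ≤ N' := by
    intro m hm
    have h1 : |(m 2 : ℝ) - mb 2| ≤ N₂ := by
      rw [abs_le]
      have := hN₂ m hm; have := hN₂ mb hmb
      constructor
      · have : (mb 2 : ℝ) ≤ N₂ := by exact_mod_cast hN₂ mb hmb
        linarith [(Nat.cast_nonneg (m 2) : (0 : ℝ) ≤ m 2)]
      · have : (m 2 : ℝ) ≤ N₂ := by exact_mod_cast hN₂ m hm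
        linarith [(Nat.cast_nonneg (mb 2) : (0 : ℝ) ≤ mb 2)]
    exact (mul_le_mul_of_nonneg_right h1 (abs_nonneg μ)).trans (Nat.le_ceil _)
  -- the off-edge part
  set E : ℂ → ℂ := fun z => ∑ m ∈ Nf, P.coeff m * z ^ (m 0) *
    exp ((((m 1 : ℝ) - s * m 2 - ((mb 1 : ℝ) - s * mb 2) : ℝ) : ℂ) * z +
      (((m 2 : ℝ) - mb 2 : ℝ) : ℂ) * R₀.eval z) with hEdef
  have hEdiff : Differentiable ℂ E := differentiable_offEdgeSum₃
  have hEb : ∀ B : ℝ, ∃ C : ℝ, 0 ≤ C ∧ ∃ N'' : ℕ, ∀ z : ℂ, z.re ≤ 0 → 1 ≤ ‖z‖ →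
      |(R₀.eval z).re - μ * Real.log ‖z‖| ≤ B →
        ‖E z‖ ≤ C * (1 + ‖z‖) ^ N'' * Real.exp (δ * z.re) := by
    intro B
    refine ⟨∑ m ∈ Nf, ‖P.coeff m‖ * Real.exp (|(m 2 : ℝ) - mb 2| * B),
      Finset.sum_nonneg fun m _ => by positivity, N + N', fun z hz hz1 hzB => ?_⟩
    exact norm_offEdgeSum₃_le_log hδ hN hN' hz hz1 hzB
  -- engine v3
  obtain ⟨z, L, hL, hz⟩ := exists_escape_zeros_log R₀ hdR M q e μ κ hκ' hθ0 hθ hQ E hEdiff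
    hδpos hEb
  refine ⟨z, fun k => ?_, tendsto_abs_re_div_log_of_linear hL (fun k => (hz k).2.1)
    (fun k => (hz k).2.2)⟩
  rw [eval₃_exp_eq_mul_edgeSum hE2 (z k)]
  have h := (hz k).1
  rw [hEdef] at h
  rw [h, mul_zero]

end Summit.Schanuel.Schanuel.Theorems
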